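import Mathlib
import HarnessLib
import Summits.SmoothPoincare4.SmoothPoincare4.Theses.LegendrianSphereS7

/-!
# Birth skeleton (BC3) — crux `LegendrianSphereS7.NearbyLagrangianSphereFour` (stmt-SmoothPoincare4-4229)

Route `route-SmoothPoincare4-LegendrianSphereS7`, crux #2 (the route's CONDITIONAL, smooth nearby Lagrangian
conjecture for `S⁴`): every closed connected smooth 4-manifold `M` carrying an exact Lagrangian embedding into
`(T*S⁴, λ_can)` — in the route's model `T*S⁴ = TS⁴ = {(q,p) ∈ ℝ⁵ × ℝ⁵ : ‖q‖ = 1, ⟪q,p⟫ = 0}`, `λ = ⟪p, dq⟫`: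
smooth `q p : M → ℝ⁵`, `g : M → ℝ` with `‖q‖ = 1`, `⟪q,p⟫ = 0`, `(q,p)` an injective immersion, `dg = ⟪p, Dq·⟫` —
is diffeomorphic to `S⁴`.

THE LINE = the route file's own foreseen glued split of this node (route header, TWO-LAYER PLAN:
"NearbyLagrangianSphereFour ⇐ OnePointNormalisation → UnknotFillings"), typed in CLOSED form over the route's
`(q,p,g)` model (no manifolds with boundary needed), with the known Floer-theoretic input isolated as its own stub:

* `stub_projectionHomotopyEquivalence` (K, KNOWN IN PRINT, size XL in Lean): for a closed connected exact
  Lagrangian `M ↪ T*S⁴` the projection `q = π ∘ ι : M → S⁴` is a homotopy equivalence (Abouzaid 2012, Invent.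
  Math. 189, Thm 1.1 "nearby Lagrangians with vanishing Maslov class are homotopy equivalent" + Kragh 2013, Geom.
  Topol. 17, Thm 1.2/Cor. (Maslov class vanishes, projection is a homotopy equivalence); Abouzaid–Kragh 2018:
  even simple homotopy equivalence). Typed: `∃ e : M ≃ₕ S⁴, ∀ x, e x = q x`. It feeds BOTH other stubs (degree
  `±1` of `q` for the normalisation; homotopy type `M ≃ S⁴` for the recognition).
* `stub_onePointNormalisation` (A, OPEN, the geometric half): if `M` admits exact Lagrangian data `(q,p,g)` with
  `q` a homotopy equivalence, then `M` admits (possibly different) exact Lagrangian data `(q',p',g')` meeting SOME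
  cotangent fibre `T*_a S⁴` in exactly one point, transversally: `∃ x₀, q'⁻¹(q' x₀) = {x₀}` and `D q'(x₀)`
  injective (`L ⋔ F_a` at `z` iff `dπ|_{T_z L}` is injective, as `T_z F_a = ker dπ`). True for the zero section
  (every fibre); expected mechanism: `q` has degree `±1` (K), make `q` transverse to a fibre by a `C^∞`-small
  Hamiltonian perturbation, then cancel excess pairs of intersections with `F_a` (algebraic count `±1`; Floer
  complex `CW(L, F_a)` has rank-one homology since `L` is Floer-theoretically the zero section) by exact Lagrangian
  isotopy / Lagrangian handle moves in the 8-dimensional ambient space. Why it might fail: excess intersections may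
  be unremovable among EXACT LAGRANGIAN embeddings of an exotic `M` (no Lagrangian Whitney trick; rank of Floer
  homology ≠ geometric count in general). Weaker than the crux (crux ⇒ `M ≅ S⁴` ⇒ re-embed `M` as the zero section).
* `stub_onePointRecognition` (B, OPEN, the filling half = "UnknotFillings" in closed form): a closed connected
  `M` with exact Lagrangian data `(q,p,g)`, `q` a homotopy equivalence, meeting one fibre `F_a` in exactly one
  transverse point `x₀`, is diffeomorphic to `S⁴`. Content: removing a Weinstein neighbourhood of `F_a` from
  `T*S⁴` leaves the standard ball `B⁸ = D(T*ℝ⁴)`, and `M ∖ ν(x₀)` is an exact Lagrangian filling in `B⁸_std` of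
  the Legendrian unknot `Λ₀ ⊂ (S⁷, ξ_std)` which closes up (by one 4-handle = the disc `M ∩ ν(F_a)`) to the
  homotopy sphere `M`; so B = "exact Lagrangian fillings of `Λ₀ ⊂ S⁷` that cap off to homotopy 4-spheres are
  diffeomorphic to `D⁴`" — the 8-dimensional Eliashberg–Polterovich statement (EliashbergPolterovich1996 is
  `n = 2`: fillings of the unknot in `B⁴` are discs; in general dimension such fillings are known to be homology
  balls / contractible (Chantraine–Dimitroglou Rizell–Ghiggini–Golovko; Kim–Kwon 2024 Thm A) and diffeomorphic to
  the ball only for `n ≥ 6` via the h-cobordism theorem (Kim–Kwon 2024 Thm B) — void at `n = 4`). Why it might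
  fail: a punctured exotic homotopy 4-sphere might be an exact filling of `Λ₀`; Floer theory sees only its
  contractibility. Weaker than the crux (one extra, genuinely restrictive hypothesis).
* `nearbyLagrangianSphereFour_of_stubs : K-sig → A-sig → B-sig → (crux unfolded)` — THE REAL COMPOSITION,
  sorry-free, pure logic: given data on `M`, K gives the homotopy equivalence, A re-embeds `M` with the one-point
  property, K again on the new data, B recognises `M ≅ S⁴`.
* `NearbyLagrangianSphereFour_of : LegendrianSphereS7.NearbyLagrangianSphereFour` — THE SKELETON THEOREM: the crux
  BY NAME from the three declared stubs through the composition (the file's only theorem whose head is the crux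
  constant; it depends on `sorryAx` only through the `stub_*`).

`sorry` occurs ONLY in the three `stub_*` theorems. All three stubs are implied by SPC4 (given K for A and B:
`M ≃ₕ S⁴` + SPC4 ⇒ `M ≅ S⁴`), so none is stronger than the summit; none implies the crux or the summit cheaply
(BC3 probes, see the registrar's `bc/probe_*.lean`: all fail).

## Disproof used

None exists: `ledger crux ls stmt-SmoothPoincare4-4229` shows no workfiles (no `Disproof.lean`, no dead lines, no
landed `Theorems/NearbyLagrangianSphereFour/Negative/` lemma) and `ledger negatives --problem SmoothPoincare4` lists
0 refuted statements (2026-08-17). The stubs inherit the crux's audited typing (model `TS⁴ ⊂ ℝ⁵ × ℝ⁵`, `λ = ⟪p,dq⟫`;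
`ConnectedSpace M` excludes the empty manifold; the zero section of `S⁴` inhabits the hypotheses, machine-checked by
the route planner in SketchSanity.lean).

## References

* M. Abouzaid, *Nearby Lagrangians with vanishing Maslov class are homotopy equivalent*, Invent. Math. 189 (2012),
  Thm 1.1. [Abouzaid2012NearbyMaslov]
* T. Kragh, *Parametrized ring-spectra and the nearby Lagrangian conjecture*, Geom. Topol. 17 (2013) (with an
  appendix by M. Abouzaid), Thm 1.2. [Kragh2013]
* M. Abouzaid, T. Kragh, *Simple homotopy equivalence of nearby Lagrangians*, Acta Math. 220 (2018). [AbouzaidKragh2018]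
* K. Fukaya, P. Seidel, I. Smith, *Exact Lagrangian submanifolds in simply-connected cotangent bundles*, Invent.
  Math. 172 (2008). [FukayaSeidelSmith2007]
* T. Ekholm, T. Kragh, I. Smith, *Lagrangian exotic spheres*, J. Topol. Anal. 8 (2016), p. 3 and §3.6
  (arXiv:1503.00473). [EkholmKraghSmith2016]
* Y. Eliashberg, L. Polterovich, *Local Lagrangian 2-knots are trivial*, Ann. of Math. 144 (1996), Thm 1.1.
  [EliashbergPolterovich1996]
* K. Cieliebak, Y. Eliashberg, *From Stein to Weinstein and Back*, AMS Colloq. Publ. 59 (2012), Ch. 11–14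
  (Weinstein neighbourhoods / handles). [CieliebakEliashberg2012]
* J. Kim, M. Kwon, J. Symplectic Geom. 22 (2024), Thms A/B (doi:10.4310/jsg.241001212513); B. Chantraine,
  G. Dimitroglou Rizell, P. Ghiggini, R. Golovko (arXiv:1501.04258, Thm 4.7) — fillings of the Legendrian unknot
  are homology balls / contractible (cited as in the route file).
-/

-- `Summit.<Summit>.<Problem>`: single-conjunct summit, the duplicate component is mandated (CONVENTIONS §2).
set_option linter.dupNamespace false
set_option linter.unusedVariables false

noncomputable section

namespace Summit.SmoothPoincare4.SmoothPoincare4.Cruxes.NearbyLagrangianSphereFour.Birth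

open scoped Manifold ContDiff ContinuousMap Topology InnerProductSpace
open Summit.SmoothPoincare4.SmoothPoincare4.Theses.LegendrianSphereS7 (NearbyLagrangianSphereFour)

/-! ## The three registered stubs (vocabulary = the crux's: Mathlib `ContMDiff`, `mfderiv`, `TangentSpace`,
`Metric.sphere`, `Diffeomorph`, `ContinuousMap.HomotopyEquiv`; no new notions) -/

/-- **Stub K `stub_projectionHomotopyEquivalence` — the projection of a closed exact Lagrangian to the base is a
homotopy equivalence (KNOWN: Abouzaid 2012 Thm 1.1 + Kragh 2013; Abouzaid–Kragh 2018).** For every closed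
connected smooth 4-manifold `M` with exact Lagrangian data `(q,p,g)` in `TS⁴ ⊂ ℝ⁵ × ℝ⁵` (the crux's hypotheses
verbatim), there is a homotopy equivalence `e : M ≃ₕ S⁴` whose underlying map is `q`. True in print for every
closed exact Lagrangian in any cotangent bundle `T*N` of a closed manifold; formalising it is a Floer-theory
programme (size XL). [Abouzaid2012NearbyMaslov, Thm 1.1] [Kragh2013, Thm 1.2] [AbouzaidKragh2018]
[FukayaSeidelSmith2007] -/
theorem stub_projectionHomotopyEquivalence :
    ∀ (M : Type) [TopologicalSpace M] [T2Space M] [SecondCountableTopology M] [CompactSpace M] [ConnectedSpace M] [ChartedSpace (EuclideanSpace ℝ (Fin 4)) M] [IsManifold (𝓡 4) ∞ M] (q p : M → EuclideanSpace ℝ (Fin 5)) (g : M → ℝ), ContMDiff (𝓡 4) 𝓘(ℝ, EuclideanSpace ℝ (Fin 5)) ∞ q → ContMDiff (𝓡 4) 𝓘(ℝ, EuclideanSpace ℝ (Fin 5)) ∞ p → ContMDiff (𝓡 4) 𝓘(ℝ, ℝ) ∞ g → (∀ x, ‖q x‖ = 1 ∧ ⟪q x, p x⟫_ℝ = 0)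 → (∀ x y, q x = q y → p x = p y → x = y) → (∀ x (v : TangentSpace (𝓡 4) x), mfderiv (𝓡 4) 𝓘(ℝ, EuclideanSpace ℝ (Fin 5)) q x v = 0 → mfderiv (𝓡 4) 𝓘(ℝ, EuclideanSpace ℝ (Fin 5)) p x v = 0 → v = 0) → (∀ x (v : TangentSpace (𝓡 4) x), mfderiv (𝓡 4) 𝓘(ℝ, ℝ) g x v = ⟪p x, mfderiv (𝓡 4) 𝓘(ℝ, EuclideanSpace ℝ (Fin 5)) q x v⟫_ℝ) → ∃ e : ContinuousMap.HomotopyEquiv M (Metric.sphere (0 : EuclideanSpace ℝ (Fin 5)) 1), ∀ x, (e x : EuclideanSpace ℝ (Fin 5)) = q x := by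
  sorry

/-- **Stub A `stub_onePointNormalisation` — one-point normalisation (OPEN; the route's foreseen child
"OnePointNormalisation", existence form).** If a closed connected smooth 4-manifold `M` carries exact Lagrangian
data `(q,p,g)` in `TS⁴` whose projection `q` is a homotopy equivalence `M → S⁴`, then `M` carries exact Lagrangian
data `(q',p',g')` (same seven clauses) meeting some cotangent fibre in exactly one point, transversally: there is
`x₀` with `q' x = q' x₀ → x = x₀` and `mfderiv q' x₀` injective. True for `M = S⁴` (zero section); expected via
degree `±1` of `q`, transversality to a fibre and cancellation of excess fibre intersections by exact Lagrangian
moves in dimension 8. Why it might fail: no Lagrangian Whitney trick — excess intersections of an exotic exact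
Lagrangian with every fibre might be forced. Size XL. [EkholmKraghSmith2016, §3.6] [CieliebakEliashberg2012, Ch. 14]
[Abouzaid2012NearbyMaslov] -/
theorem stub_onePointNormalisation :
    ∀ (M : Type) [TopologicalSpace M] [T2Space M] [SecondCountableTopology M] [CompactSpace M] [ConnectedSpace M] [ChartedSpace (EuclideanSpace ℝ (Fin 4)) M] [IsManifold (𝓡 4) ∞ M] (q p : M → EuclideanSpace ℝ (Fin 5)) (g : M → ℝ), ContMDiff (𝓡 4) 𝓘(ℝ, EuclideanSpace ℝ (Fin 5)) ∞ q → ContMDiff (𝓡 4) 𝓘(ℝ, EuclideanSpace ℝ (Fin 5)) ∞ p → ContMDiff (𝓡 4) 𝓘(ℝ, ℝ) ∞ g → (∀ x, ‖q x‖ = 1 ∧ ⟪q x, p x⟫_ℝ = 0) → (∀ x y, q x = q y → p x = p y → x = y) → (∀ x (v : TangentSpace (𝓡 4) x), mfderiv (𝓡 4) 𝓘(ℝ, EuclideanSpace ℝ (Fin 5)) q x v = 0 → mfderiv (𝓡 4) 𝓘(ℝ, EuclideanSpace ℝ (Fin 5)) p x v = 0 → v = 0) → (∀ x (v : TangentSpace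 (𝓡 4) x), mfderiv (𝓡 4) 𝓘(ℝ, ℝ) g x v = ⟪p x, mfderiv (𝓡 4) 𝓘(ℝ, EuclideanSpace ℝ (Fin 5)) q x v⟫_ℝ) → (∃ e : ContinuousMap.HomotopyEquiv M (Metric.sphere (0 : EuclideanSpace ℝ (Fin 5)) 1), ∀ x, (e x : EuclideanSpace ℝ (Fin 5)) = q x) → ∃ (q' p' : M → EuclideanSpace ℝ (Fin 5)) (g' : M → ℝ), ContMDiff (𝓡 4) 𝓘(ℝ, EuclideanSpace ℝ (Fin 5)) ∞ q' ∧ ContMDiff (𝓡 4) 𝓘(ℝ, EuclideanSpace ℝ (Fin 5)) ∞ p' ∧ ContMDiff (𝓡 4) 𝓘(ℝ, ℝ) ∞ g' ∧ (∀ x, ‖q' x‖ = 1 ∧ ⟪q' x, p' x⟫_ℝ = 0) ∧ (∀ x y, q' x = q' y → p' x = p' y → x = y) ∧ (∀ x (v : TangentSpace (𝓡 4) x), mfderiv (𝓡 4) 𝓘(ℝ, EuclideanSpace ℝ (Fin 5)) q' x v = 0 → mfderiv (𝓡 4) 𝓘(ℝ, EuclideanSpace ℝ (Fin 5)) p' x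 v = 0 → v = 0) ∧ (∀ x (v : TangentSpace (𝓡 4) x), mfderiv (𝓡 4) 𝓘(ℝ, ℝ) g' x v = ⟪p' x, mfderiv (𝓡 4) 𝓘(ℝ, EuclideanSpace ℝ (Fin 5)) q' x v⟫_ℝ) ∧ ∃ x₀ : M, (∀ x, q' x = q' x₀ → x = x₀) ∧ Function.Injective (mfderiv (𝓡 4) 𝓘(ℝ, EuclideanSpace ℝ (Fin 5)) q' x₀) := by
  sorry

/-- **Stub B `stub_onePointRecognition` — recognition in one-point normal form (OPEN; the route's foreseen child
"UnknotFillings" in closed form).** A closed connected smooth 4-manifold `M` with exact Lagrangian data `(q,p,g)` in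
`TS⁴`, `q` a homotopy equivalence onto `S⁴`, meeting one cotangent fibre in exactly one transverse point `x₀`
(`q x = q x₀ → x = x₀`, `mfderiv q x₀` injective) is diffeomorphic to `S⁴`. Content: `M` minus a disc around `x₀` is
an exact Lagrangian filling, inside the standard ball `B⁸ = T*S⁴ ∖ ν(T*_a S⁴)`, of the Legendrian unknot
`Λ₀ ⊂ (S⁷, ξ_std)`, capping off to the homotopy sphere `M`; B says such fillings are 4-balls (8-dimensional
Eliashberg–Polterovich; known: homology balls / contractible, ball for `n ≥ 6`). Why it might fail: a punctured
exotic homotopy 4-sphere may fill `Λ₀`; Floer theory only sees contractibility. Size XL.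
[EliashbergPolterovich1996, Thm 1.1] [EkholmKraghSmith2016, §3.6] [CieliebakEliashberg2012, Ch. 11–12] -/
theorem stub_onePointRecognition :
    ∀ (M : Type) [TopologicalSpace M] [T2Space M] [SecondCountableTopology M] [CompactSpace M] [ConnectedSpace M] [ChartedSpace (EuclideanSpace ℝ (Fin 4)) M] [IsManifold (𝓡 4) ∞ M] (q p : M → EuclideanSpace ℝ (Fin 5)) (g : M → ℝ), ContMDiff (𝓡 4) 𝓘(ℝ, EuclideanSpace ℝ (Fin 5)) ∞ q → ContMDiff (𝓡 4) 𝓘(ℝ, EuclideanSpace ℝ (Fin 5)) ∞ p → ContMDiff (𝓡 4) 𝓘(ℝ, ℝ) ∞ g → (∀ x, ‖q x‖ = 1 ∧ ⟪q x, p x⟫_ℝ = 0) → (∀ x y, q x = q y → p x = p y → x = y) → (∀ x (v : TangentSpace (𝓡 4) x), mfderiv (𝓡 4) 𝓘(ℝ, EuclideanSpace ℝ (Fin 5)) q x v = 0 → mfderiv (𝓡 4) 𝓘(ℝ, EuclideanSpace ℝ (Fin 5)) p x v = 0 → v = 0) → (∀ x (v : TangentSpace (𝓡 4) x), mfderiv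 (𝓡 4) 𝓘(ℝ, ℝ) g x v = ⟪p x, mfderiv (𝓡 4) 𝓘(ℝ, EuclideanSpace ℝ (Fin 5)) q x v⟫_ℝ) → (∃ e : ContinuousMap.HomotopyEquiv M (Metric.sphere (0 : EuclideanSpace ℝ (Fin 5)) 1), ∀ x, (e x : EuclideanSpace ℝ (Fin 5)) = q x) → ∀ x₀ : M, (∀ x, q x = q x₀ → x = x₀) → Function.Injective (mfderiv (𝓡 4) 𝓘(ℝ, EuclideanSpace ℝ (Fin 5)) q x₀) → Nonempty (M ≃ₘ⟮𝓡 4, 𝓡 4⟯ Metric.sphere (0 : EuclideanSpace ℝ (Fin 5)) 1) := by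
  sorry

/-! ## The composition: K, A, B prove the crux (pure logic) -/

/-- **Composition with explicit hypotheses** (`K-sig → A-sig → B-sig → crux`, the conclusion written as the crux's
one-step unfolding so that `NearbyLagrangianSphereFour_of` below is the file's only theorem whose head is the crux
name). Proof: given exact Lagrangian data `(q,p,g)` on `M`, K makes `q` a homotopy equivalence; A re-embeds `M` with
data `(q',p',g')` meeting one fibre in exactly one transverse point `x₀`; K again for `q'`; B yields `M ≃ₘ S⁴`.
Sorry-free. [folklore] -/
theorem nearbyLagrangianSphereFour_of_stubs
    (hK : ∀ (M : Type) [TopologicalSpace M] [T2Space M] [SecondCountableTopology M] [CompactSpace M] [ConnectedSpace M] [ChartedSpace (EuclideanSpace ℝ (Fin 4)) M] [IsManifold (𝓡 4) ∞ M] (q p : M → EuclideanSpace ℝ (Fin 5)) (g : M → ℝ), ContMDiff (𝓡 4) 𝓘(ℝ, EuclideanSpace ℝ (Fin 5)) ∞ q → ContMDiff (𝓡 4) 𝓘(ℝ, EuclideanSpace ℝ (Fin 5)) ∞ p → ContMDiff (𝓡 4) 𝓘(ℝ, ℝ) ∞ g → (∀ x, ‖q x‖ = 1 ∧ ⟪q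 x, p x⟫_ℝ = 0) → (∀ x y, q x = q y → p x = p y → x = y) → (∀ x (v : TangentSpace (𝓡 4) x), mfderiv (𝓡 4) 𝓘(ℝ, EuclideanSpace ℝ (Fin 5)) q x v = 0 → mfderiv (𝓡 4) 𝓘(ℝ, EuclideanSpace ℝ (Fin 5)) p x v = 0 → v = 0) → (∀ x (v : TangentSpace (𝓡 4) x), mfderiv (𝓡 4) 𝓘(ℝ, ℝ) g x v = ⟪p x, mfderiv (𝓡 4) 𝓘(ℝ, EuclideanSpace ℝ (Fin 5)) q x v⟫_ℝ) → ∃ e : ContinuousMap.HomotopyEquiv M (Metric.sphere (0 : EuclideanSpace ℝ (Fin 5)) 1), ∀ x, (e x : EuclideanSpace ℝ (Fin 5)) = q x)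
    (hA : ∀ (M : Type) [TopologicalSpace M] [T2Space M] [SecondCountableTopology M] [CompactSpace M] [ConnectedSpace M] [ChartedSpace (EuclideanSpace ℝ (Fin 4)) M] [IsManifold (𝓡 4) ∞ M] (q p : M → EuclideanSpace ℝ (Fin 5)) (g : M → ℝ), ContMDiff (𝓡 4) 𝓘(ℝ, EuclideanSpace ℝ (Fin 5)) ∞ q → ContMDiff (𝓡 4) 𝓘(ℝ, EuclideanSpace ℝ (Fin 5)) ∞ p → ContMDiff (𝓡 4) 𝓘(ℝ, ℝ) ∞ g → (∀ x, ‖q x‖ = 1 ∧ ⟪q x, p x⟫_ℝ = 0) → (∀ x y, q x = q y → p x = p y → x = y) → (∀ x (v : TangentSpace (𝓡 4) x), mfderiv (𝓡 4) 𝓘(ℝ, EuclideanSpace ℝ (Fin 5)) q x v = 0 → mfderiv (𝓡 4) 𝓘(ℝ, EuclideanSpace ℝ (Fin 5)) p x v = 0 → v = 0) → (∀ x (v : TangentSpace (𝓡 4) x), mfderiv (𝓡 4) 𝓘(ℝ, ℝ) g x v = ⟪p x, mfderiv (𝓡 4) 𝓘(ℝ, EuclideanSpace ℝ (Fin 5))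 q x v⟫_ℝ) → (∃ e : ContinuousMap.HomotopyEquiv M (Metric.sphere (0 : EuclideanSpace ℝ (Fin 5)) 1), ∀ x, (e x : EuclideanSpace ℝ (Fin 5)) = q x) → ∃ (q' p' : M → EuclideanSpace ℝ (Fin 5)) (g' : M → ℝ), ContMDiff (𝓡 4) 𝓘(ℝ, EuclideanSpace ℝ (Fin 5)) ∞ q' ∧ ContMDiff (𝓡 4) 𝓘(ℝ, EuclideanSpace ℝ (Fin 5)) ∞ p' ∧ ContMDiff (𝓡 4) 𝓘(ℝ, ℝ) ∞ g' ∧ (∀ x, ‖q' x‖ = 1 ∧ ⟪q' x, p' x⟫_ℝ = 0) ∧ (∀ x y, q' x = q' y → p' x = p' y → x = y) ∧ (∀ x (v : TangentSpace (𝓡 4) x), mfderiv (𝓡 4) 𝓘(ℝ, EuclideanSpace ℝ (Fin 5)) q' x v = 0 → mfderiv (𝓡 4) 𝓘(ℝ, EuclideanSpace ℝ (Fin 5)) p' x v = 0 → v = 0) ∧ (∀ x (v : TangentSpace (𝓡 4) x), mfderiv (𝓡 4) 𝓘(ℝ, ℝ) g' x v = ⟪p' x, mfderiv (𝓡 4)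 𝓘(ℝ, EuclideanSpace ℝ (Fin 5)) q' x v⟫_ℝ) ∧ ∃ x₀ : M, (∀ x, q' x = q' x₀ → x = x₀) ∧ Function.Injective (mfderiv (𝓡 4) 𝓘(ℝ, EuclideanSpace ℝ (Fin 5)) q' x₀))
    (hB : ∀ (M : Type) [TopologicalSpace M] [T2Space M] [SecondCountableTopology M] [CompactSpace M] [ConnectedSpace M] [ChartedSpace (EuclideanSpace ℝ (Fin 4)) M] [IsManifold (𝓡 4) ∞ M] (q p : M → EuclideanSpace ℝ (Fin 5)) (g : M → ℝ), ContMDiff (𝓡 4) 𝓘(ℝ, EuclideanSpace ℝ (Fin 5)) ∞ q → ContMDiff (𝓡 4) 𝓘(ℝ, EuclideanSpace ℝ (Fin 5)) ∞ p → ContMDiff (𝓡 4) 𝓘(ℝ, ℝ) ∞ g → (∀ x, ‖q x‖ = 1 ∧ ⟪q x, p x⟫_ℝ = 0) → (∀ x y, q x = q y → p x = p y → x = y) → (∀ x (v : TangentSpace (𝓡 4) x), mfderiv (𝓡 4) 𝓘(ℝ, EuclideanSpace ℝ (Fin 5)) q x v = 0 → mfderiv (𝓡 4) 𝓘(ℝ,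 EuclideanSpace ℝ (Fin 5)) p x v = 0 → v = 0) → (∀ x (v : TangentSpace (𝓡 4) x), mfderiv (𝓡 4) 𝓘(ℝ, ℝ) g x v = ⟪p x, mfderiv (𝓡 4) 𝓘(ℝ, EuclideanSpace ℝ (Fin 5)) q x v⟫_ℝ) → (∃ e : ContinuousMap.HomotopyEquiv M (Metric.sphere (0 : EuclideanSpace ℝ (Fin 5)) 1), ∀ x, (e x : EuclideanSpace ℝ (Fin 5)) = q x) → ∀ x₀ : M, (∀ x, q x = q x₀ → x = x₀) → Function.Injective (mfderiv (𝓡 4) 𝓘(ℝ, EuclideanSpace ℝ (Fin 5)) q x₀) → Nonempty (M ≃ₘ⟮𝓡 4, 𝓡 4⟯ Metric.sphere (0 : EuclideanSpace ℝ (Fin 5)) 1)) :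
    ∀ (M : Type) [TopologicalSpace M] [T2Space M] [SecondCountableTopology M] [CompactSpace M] [ConnectedSpace M]
      [ChartedSpace (EuclideanSpace ℝ (Fin 4)) M] [IsManifold (𝓡 4) ∞ M]
      (q p : M → EuclideanSpace ℝ (Fin 5)) (g : M → ℝ),
      ContMDiff (𝓡 4) 𝓘(ℝ, EuclideanSpace ℝ (Fin 5)) ∞ q →
      ContMDiff (𝓡 4) 𝓘(ℝ, EuclideanSpace ℝ (Fin 5)) ∞ p →
      ContMDiff (𝓡 4) 𝓘(ℝ, ℝ) ∞ g →
      (∀ x, ‖q x‖ = 1 ∧ ⟪q x, p x⟫_ℝ = 0) →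
      (∀ x y, q x = q y → p x = p y → x = y) →
      (∀ x (v : TangentSpace (𝓡 4) x), mfderiv (𝓡 4) 𝓘(ℝ, EuclideanSpace ℝ (Fin 5)) q x v = 0 →
        mfderiv (𝓡 4) 𝓘(ℝ, EuclideanSpace ℝ (Fin 5)) p x v = 0 → v = 0) →
      (∀ x (v : TangentSpace (𝓡 4) x), mfderiv (𝓡 4) 𝓘(ℝ, ℝ) g x v =
        ⟪p x, mfderiv (𝓡 4) 𝓘(ℝ, EuclideanSpace ℝ (Fin 5)) q x v⟫_ℝ) →
      Nonempty (M ≃ₘ⟮𝓡 4, 𝓡 4⟯ Metric.sphere (0 : EuclideanSpace ℝ (Fin 5)) 1) := by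
  intro M _ _ _ _ _ _ _ q p g hq hp hg hsph hinj himm hex
  -- K: the projection `q` is a homotopy equivalence; A: re-embed `M` with the one-point property
  obtain ⟨q', p', g', hq', hp', hg', hsph', hinj', himm', hex', x₀, hone, htr⟩ :=
    hA M q p g hq hp hg hsph hinj himm hex (hK M q p g hq hp hg hsph hinj himm hex)
  -- K again for the new data; B: recognition in one-point normal form
  exact hB M q' p' g' hq' hp' hg' hsph' hinj' himm' hex'
    (hK M q' p' g' hq' hp' hg' hsph' hinj' himm' hex') x₀ hone htr

/-- **THE SKELETON THEOREM.** The crux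
`Summit.SmoothPoincare4.SmoothPoincare4.Theses.LegendrianSphereS7.NearbyLagrangianSphereFour`, concluded BY NAME
from the three DECLARED stubs `stub_projectionHomotopyEquivalence`, `stub_onePointNormalisation`,
`stub_onePointRecognition` (the only `sorry`s of the file) through the sorry-free composition
`nearbyLagrangianSphereFour_of_stubs`. [folklore] -/
theorem NearbyLagrangianSphereFour_of :
    Summit.SmoothPoincare4.SmoothPoincare4.Theses.LegendrianSphereS7.NearbyLagrangianSphereFour :=
  nearbyLagrangianSphereFour_of_stubs stub_projectionHomotopyEquivalence stub_onePointNormalisation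
    stub_onePointRecognition

end Summit.SmoothPoincare4.SmoothPoincare4.Cruxes.NearbyLagrangianSphereFour.Birth

end
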